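import Summits.AtomisticToContinuum.Crystallization.Theorems.ExcessDecayLiouvilleCoarseGrainsPinGridA
import Summits.AtomisticToContinuum.Crystallization.Theorems.ExcessDecayLiouvilleCoarseGrainsPinFromSeries
import Summits.AtomisticToContinuum.Crystallization.Theorems.ExcessDecayLiouvilleCoarseGrainsHcpEnergySeries

/-!
# Crux `PeriodicWindows` (stmt-AtomisticToContinuum-3240), line `Sketch` — stub E2c: one certified hcp value

Stub `stub_hcpTrialEnergy` of the lead skeleton `PeriodicWindowsSketch` (rev 9, route
`ChessboardParticlePlanes`): SOME relaxed hexagonal close packing `hcpPeriodicConfiguration ha hh`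
(`BarlowStacking.lean`) has Lennard-Jones energy per particle `≤ -0.71749` (the true optimum is
`≈ -0.717591`, at `a ≈ 0.9712`, `h/a ≈ 0.8165`).

Proof. Take the shape `c = 8164/10000` and the optimal dilation `b = (S₆/S₃)^{1/6}` of that shape,
`Sₑ = hcpSumS e c = ∑_{v ≠ 0} (Q v + k² c²)⁻ᵉ` (`ExcessDecayLiouvilleCoarseGrainsPinSums`), and the hcp
`(a, h) = (b, b c)`. By the series representation of the hcp energy
(`ExcessDecayLiouvilleCoarseGrains.hcpEnergySeries_of_eq`) and the series algebra
`hcpPinC_energy_formula`, `e = ½ (b⁻¹² S₆/12 - b⁻⁶ S₃/6)`, which at `b⁶ = S₆/S₃` is `-S₃²/(24 S₆)`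
(`hcpPinC_dilation_value`). The certified grid bounds `hcpSum_grid_8164` (`S₃ ≥ 14.457431022`,
`S₆ ≤ 12.138038647`) give `e ≤ -(14.457431022)²/(24 · 12.138038647) = -0.7175009… ≤ -0.71749`.
-/

noncomputable section

namespace Summit.AtomisticToContinuum.Crystallization.Theorems.PeriodicWindowsSketch

open Literature.MathematicalPhysics.StatisticalMechanics
open Summit.AtomisticToContinuum.Crystallization.Theorems.ExcessDecayLiouvilleCoarseGrains

/-- The energy per particle of the hcp of shape `c` (`c² ≥ 3/5`) at its optimal dilation
`b = (S₆ c/S₃ c)^{1/6}`: `e(hcp(b, b c)) = -(S₃ c)²/(24 S₆ c)` with `Sₑ = hcpSumS e c`. [folklore] -/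
theorem hcpTrialEnergy_dilated {c : ℝ} (hc0 : 0 < c) (hc : 3 / 5 ≤ c ^ 2) :
    ∃ (b : ℝ) (hb : b ≠ 0) (hbc : b * c ≠ 0),
      (hcpPeriodicConfiguration hb hbc).energyPerParticle lennardJones =
        -(hcpSumS 3 c ^ 2 / (24 * hcpSumS 6 c)) := by
  have h3 : 0 < hcpSumS 3 c := one_pos.trans_le (hcpSum_one_le_hcpSumS (by norm_num) hc)
  have h6 : 0 < hcpSumS 6 c := one_pos.trans_le (hcpSum_one_le_hcpSumS (by norm_num) hc)
  have hq : 0 < hcpSumS 6 c / hcpSumS 3 c := div_pos h6 h3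
  obtain ⟨b, hb0, hb6⟩ : ∃ b : ℝ, 0 < b ∧ b ^ 6 = hcpSumS 6 c / hcpSumS 3 c :=
    ⟨(hcpSumS 6 c / hcpSumS 3 c) ^ ((6 : ℕ) : ℝ)⁻¹, Real.rpow_pos_of_pos hq _,
      Real.rpow_inv_natCast_pow hq.le (by norm_num)⟩
  have hbc : b * c ≠ 0 := mul_ne_zero hb0.ne' hc0.ne'
  refine ⟨b, hb0.ne', hbc, ?_⟩
  obtain ⟨hA1, hA2, hA3⟩ := hcpEnergySeries_of_eq b (b * c) hb0.ne' hbc hcpSumQ rfl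
  have key := (hcpPinC_energy_formula hcpSumQ hcpPinC_Q_nonneg hb0.ne' hA1 hA2 hA3).2.2
  rw [mul_div_cancel_left₀ c hb0.ne'] at key
  have hS : ∀ n : ℕ, (∑' v : ℤ × ℤ × ℤ,
      if v = 0 then (0 : ℝ) else ((hcpSumQ v + (v.1 : ℝ) ^ 2 * c ^ 2)⁻¹) ^ n) = hcpSumS n c :=
    fun n => rfl
  rw [hS 3, hS 6] at key
  rw [key]
  exact hcpPinC_dilation_value h3 h6 hb6

/-- **Stub E2c of line `Sketch` (crux `PeriodicWindows`, stmt-AtomisticToContinuum-3240): one certified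
hcp value.** Some relaxed hcp `hcpPeriodicConfiguration ha hh` has Lennard-Jones energy per particle
`≤ -0.71749`: the shape `c = 8164/10000` at its optimal dilation has energy `-S₃²/(24 S₆)`
(`hcpTrialEnergy_dilated`), and the certified bounds `hcpSum_grid_8164` give
`-S₃²/(24 S₆) ≤ -(14.457431022)²/(24 · 12.138038647) ≤ -0.71749`. [folklore] -/
theorem stub_hcpTrialEnergy :
    ∃ (a₁ h₁ : ℝ) (ha₁ : a₁ ≠ 0) (hh₁ : h₁ ≠ 0),
      (hcpPeriodicConfiguration ha₁ hh₁).energyPerParticle lennardJones ≤ -(71749 / 100000) := by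
  have hc0 : (0 : ℝ) < (8164 : ℝ) / 10000 := by norm_num
  have hc : (3 : ℝ) / 5 ≤ ((8164 : ℝ) / 10000) ^ 2 := by norm_num
  obtain ⟨b, hb, hbc, he⟩ := hcpTrialEnergy_dilated hc0 hc
  refine ⟨b, b * ((8164 : ℝ) / 10000), hb, hbc, ?_⟩
  rw [he]
  obtain ⟨h3l, -, h6l, h6u⟩ := hcpSum_grid_8164
  have h6 : (0 : ℝ) < hcpSumS 6 ((8164 : ℝ) / 10000) := by linarith
  rw [neg_le_neg_iff, le_div_iff₀ (by positivity)]
  nlinarith [mul_le_mul h3l h3l (by norm_num) (by linarith)]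

end Summit.AtomisticToContinuum.Crystallization.Theorems.PeriodicWindowsSketch

end
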